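import Summits.QuantumFields.YangMills.Theorems.UnitScaleTiltProp7LaplaceAFlatCoercive
import Summits.QuantumFields.YangMills.Theorems.UnitScaleTiltProp7BondAvgIterCoercivity
import HarnessLib

/-!
# Route `UnitScaleTilt`, crux «MinimiserStabilityRegPr» (stmt-QuantumFields-19200, stub EX `stub_existenceMinimalOrbit`), route (α) — «OP-ROWS FLAT CERTIFICATE»:
# **THE KERNEL OF `Q_k(1)†` READ BACK ON THE ROUTE CARRIERS IS THE TENT — `toL2⁻¹ ∘ Q_k(1)† ∘ toL2B = (cB∕c₀)·(Q_{K−n}ᵀ ∘ bondShift⁻¹)` with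
# `(Q_kᵀW)(⟨z, μ⟩) = (L^{kd}·L^k)⁻¹·Σ_{t<L^k} W(⟨proj_k(z − t e_μ), μ⟩)` — HENCE THE SUP ROW `‖toL2⁻¹(Q_k(1)†Ỹ)(b)‖ ≤ (cB∕c₀)·L^{−3(K−n)}·‖Y‖` (max fine-bond weight
# `(cB∕c₀)·η³`, no concentration on the block skeleton) AND THE `Q_k†a`-HALF OF THE DISPLAYED (137)-ROWS `h137π`∕`h137Δ` AT THE FLAT MEMBER, AT THE WEIGHT LETTER OF RECORD
# `a := a₀·(c₀∕cB)·(L^{K−n})³`, IS `≤ a₀·‖Y‖` — `K`-UNIFORM, VOLUME-UNIFORM**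

Cell `ym3-torus` (HUMAN RULING D-0037, YM ladder rung R3 — YM₃ on T³, NOT d = 4, NOT Clay; YM gap NOT proved), width seat `ym3-torus-px21` (gen 5, «width 21»).  THEOREMS ONLY (0 `def`,
0 `sorry`); `--supports stmt-QuantumFields-19200 --as helper`, count-neutral; NO claim on crux ∕ stub ∕ registry.

WHY.  The EX display of record (S21ᴸ ✓p690389, 72 binders) carries six N06-class OPERATOR ROWS in sup form — `h137π`, `hOp139′π`, `hOpCΔ`, `h137Δ`, `hTJ`, `hOp349` — whose
`K`-uniform inhabitability at the member letters rests, for the `Q_k†`-terms of (137) ([Balaban1985Variational] p.298: «`Δ_{U₀}H = Q*((QGQ*)⁻¹ − a)`» read back on the fine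
bonds), on ONE number recorded but not posted by ym3-torus-px19 g4 (HANDOFF § px19 g4 «LOCATED, NOT POSTED»): the flat kernel of `Q_k†` must be the TENT of [Balaban1984PropagatorsI]
(1.18)∕(1.21) with maximal fine-bond weight `≍ η³` (no concentration on the block skeleton), or the sup rows would fail the dimensional `K`-uniformity check that killed `hΔπn`
(✓`not_hΔπn`).  This file settles that number BY KERNEL and gives the flat-member (`U₀ = 1`) certificate of the `Q_k†a`-half of `h137π`∕`h137Δ` in the display's own letters
(★★OWNER RULING g28-№13 (c3) «A6 at the flat member by kernel»), plus — for the record — the trivial flat members of `hTJ` and `hOp139′π`.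

WHAT IS PROVED (ns `…Theorems.Prop7QkAdjointFlatKernel`).
* §1 (any torus `P`, [folklore]) `runSite_update_sub`, `update_runSite_sub`, `sum_runSite_reindex` — the start `z − t e_μ` of the straight contour through a bond, and re-indexing a torus
  sum by the contour's end point.
* §2 (any `P`, `k ≤ m + K`, matrix fields `Matrix ι ι ℂ`) ★★ `sum_trace_conjTranspose_bondAvgIter_mul` — THE TRANSPOSE IDENTITY for the trace pairing:
  `Σ_c tr((Q_kX)(c)ᴴ·W(c)) = Σ_b tr(X(b)ᴴ·(Q_kᵀW)(b))`, `Q_k = LatticeFieldCalculus.bondAvgIter k` ((1.18), via ✓`Prop7FlatCoercivity.bondAvgIter_eq_lineBlockAvg`), the tent transpose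
  written IN ONE STROKE as the sum over the `L^k` starts; ★ `norm_tentTranspose_le` — its sup row `‖(Q_kᵀW)(b)‖ ≤ L^{−kd}·max‖W‖`.
* §3 (the T³ member `F`, `h : n ≤ K`, weights `c₀ cB > 0`, background `U₀ = 1`) ★★ `toL2_symm_adjoint_Qk_one` — the EXPLICIT KERNEL of brick L0d's `LinearMap.adjoint (Qk F n K h c₀ cB 1)`
  between the weighted `L²` spaces (3.11)∕(3.16), read back by `toL2⁻¹ … toL2B` (✓`Prop7LaplaceAFlatLetters.Qk_one_toL2`: `η·L^{K−n} = 1`; uniqueness by `ext_inner_left`);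
  ★★ `norm_toL2_symm_adjoint_Qk_one_apply_le` — `≤ (cB∕c₀)·((F.L)^{K−n})^{−3}·‖Y‖`; ★★ `norm_toL2_symm_adjoint_Qk_one_smul_apply_le` — at `a := a₀·(c₀∕cB)·((F.L)^{K−n})³`
  (★p1 g17 WORD 10 ∕ ✓`Prop7LaplaceAFlatCoercive.coercive_laplaceA_one`'s weight) the `Q_k(1)†(a•toL2B Y)` term of `h137π`∕`h137Δ` is `≤ a₀·‖Y‖`.
* §4 `hTJ_row_one`, `hOp139π_row_one` — the displayed rows `hTJ`, `hOp139′π` at `U₀ = 1` hold with any nonnegative constant (✓`TJSlotP_one`, ✓`DeltaPiSlotP_one`).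
HONEST SCOPE.  Flat member only, linear bookkeeping over landed bricks; the `Q_k†(QGQ*)⁻¹`-half of (137), `hOpCΔ` and `hOp349` at `U₀ = 1` are flat-N06-class ([Balaban1984PropagatorsII])
and are NOT touched; nothing of [Balaban1985BackgroundPropagators] §3 at a curved background is asserted; no stub ∕ crux ∕ summit statement is proved or claimed.

References: T. Bałaban, CMP **95** (1984) 17–40 [Balaban1984PropagatorsI] ((1.7)–(1.8) pp.18–19, (1.11) p.19, (1.18) p.20, (1.21) p.21); CMP **99** (1985) 389–434
[Balaban1985BackgroundPropagators] (p.391, (3.11) p.392, (3.16) p.393, (3.26) p.395, (3.119) p.419, (3.127)–(3.128) p.421, (3.137) p.423); CMP **102** (1985) 277–309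
[Balaban1985Variational] ((44)–(45) p.285, (137)–(139) p.298).
-/

set_option autoImplicit false

noncomputable section

open scoped InnerProductSpace ComplexConjugate Matrix.Norms.L2Operator BigOperators Matrix

namespace Summit.QuantumFields.YangMills.Theorems.Prop7QkAdjointFlatKernel

open Literature.MathematicalPhysics.QuantumFieldTheory.Balaban1983to89
open Literature.MathematicalPhysics.QuantumFieldTheory.Balaban1983to89.T3ContinuumYM3Torus
open Finset LatticeFieldCalculus B1RG242Torus
open B10StarCount (sum_pbond)
open Summit.QuantumFields.YangMills.Theorems.Prop7FlatCoercivity (iterate_shift_eq_runSite bondAvgIter_eq_lineBlockAvg sitesPerDir_zero_eq_pow_mul)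
open B9Eq311L2Pairing (WL2)
open B11Eq103H1Complex (SiteL2K BondL2K)
open Summit.QuantumFields.YangMills.Theorems.Prop7SectET3Transport (periodsT3)
open Summit.QuantumFields.YangMills.Theorems.Prop7SectET3HilbertLetters (W₂ frobEquiv toL2 toL2B QL2 inner_toL2 inner_toL2B)
open Summit.QuantumFields.YangMills.Theorems.Prop7SectET3WilsonHessian (DeltaEta DeltaEtaSlot)
open Summit.QuantumFields.YangMills.Theorems.Prop7SectET3DeltaPiPInv (DeltaPiSlotP)
open Summit.QuantumFields.YangMills.Theorems.Prop7SectET3DeltaOnePInv (TJSlotP)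
open Summit.QuantumFields.YangMills.Theorems.Prop7SectET3CurvedPropagators (Qk)

variable {P : Params}

/-! ## §1 Straight contours backwards: the start of the contour through a given bond -/

/-- The start `z − t·e_μ` runs to `z` in `t` steps: `runSite (z − t e_μ) μ t = z`. [cite: Balaban1984PropagatorsI, (1.7)–(1.8) pp.18–19] -/
theorem runSite_update_sub {j : ℕ} (z : Site P j) (μ : Fin P.d) (t : ℕ) :
    runSite (Function.update z μ (z μ - t) : Site P j) μ t = z := by
  simp only [runSite, Function.update_idem, Function.update_self, sub_add_cancel, Function.update_eq_self]

/-- Conversely the start is recovered from the end point: `(x + t e_μ) − t e_μ = x`. [cite: Balaban1984PropagatorsI, (1.7)–(1.8) pp.18–19] -/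
theorem update_runSite_sub {j : ℕ} (x : Site P j) (μ : Fin P.d) (t : ℕ) :
    (Function.update (runSite x μ t) μ (runSite x μ t μ - t) : Site P j) = x := by
  simp only [runSite, Function.update_idem, Function.update_self, add_sub_cancel_right, Function.update_eq_self]

/-- Re-indexing a sum over the fine torus by the END POINT of the straight contour of `t` steps in the direction `μ` (a bijection of the torus):
`Σ_x G(x + t e_μ, x) = Σ_z G(z, z − t e_μ)`. [folklore] -/
theorem sum_runSite_reindex {j : ℕ} {M : Type*} [AddCommMonoid M] (μ : Fin P.d) (t : ℕ) (G : Site P j → Site P j → M) :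
    ∑ x : Site P j, G (runSite x μ t) x = ∑ z : Site P j, G z (Function.update z μ (z μ - t) : Site P j) := by
  let e : Site P j ≃ Site P j :=
    { toFun := fun x => runSite x μ t
      invFun := fun z => (Function.update z μ (z μ - t) : Site P j)
      left_inv := fun x => update_runSite_sub x μ t
      right_inv := fun z => runSite_update_sub z μ t }
  have h : ∀ x : Site P j, G (runSite x μ t) x = (fun z => G z (Function.update z μ (z μ - t) : Site P j)) (e x) := by
    intro x
    show G (runSite x μ t) x = G (runSite x μ t) (Function.update (runSite x μ t) μ (runSite x μ t μ - t) : Site P j)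
    rw [update_runSite_sub]
  simp only [h]
  exact Equiv.sum_comp e (fun z => G z (Function.update z μ (z μ - t) : Site P j))


/-! ## §2 The `k`-fold straight average transposed onto matrix weights: the TENT KERNEL of `Q_kᵀ` -/

section Transpose

variable {k : ℕ} {ι : Type*} [Fintype ι]

/-- ★★ **THE TRANSPOSE IDENTITY FOR THE TRACE PAIRING (matrix fields, any `ι`)**: for every fine bond field `X`, every coarse weight field `W` and `k` in the standing range,
`Σ_c tr((Q_kX)(c)ᴴ·W(c)) = Σ_b tr(X(b)ᴴ·(Q_kᵀW)(b))` with the TENT transpose `(Q_kᵀW)(⟨z, μ⟩) = (L^{kd}·L^k)⁻¹·Σ_{t<L^k} W(⟨proj_k(z − t e_μ), μ⟩)` — each fine bond lies on exactly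
`L^k` straight contours of (1.18), one per position `t`, started at `z − t e_μ`. [cite: Balaban1984PropagatorsI, (1.18) p.20, (1.21) p.21] -/
theorem sum_trace_conjTranspose_bondAvgIter_mul (hk : k ≤ P.m + P.K) (X : PBond P 0 → Matrix ι ι ℂ) (W : PBond P k → Matrix ι ι ℂ) :
    ∑ c : PBond P k, ((bondAvgIter k X c)ᴴ * W c).trace
      = ∑ b : PBond P 0, ((X b)ᴴ * (((((((P.L : ℝ) ^ k) ^ P.d * (P.L : ℝ) ^ k)⁻¹ : ℝ)) : ℂ) •
          ∑ t ∈ range (P.L ^ k), W ⟨Site.proj k k (Function.update b.src b.dir (b.src b.dir - t) : Site P 0), b.dir⟩)).trace := by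
  set w : ℂ := ((((((P.L : ℝ) ^ k) ^ P.d * (P.L : ℝ) ^ k)⁻¹ : ℝ)) : ℂ) with hwdef
  have hwreal : star w = w := by rw [hwdef]; exact Complex.conj_ofReal _
  -- (1.18) with the real weight read as a complex scalar and the contour as `runSite`
  have hw : ∀ c : PBond P k, bondAvgIter k X c =
      w • ∑ x ∈ univ.filter (fun x : Site P 0 => Site.proj k k x = c.src), ∑ t ∈ range (P.L ^ k), X ⟨runSite x c.dir t, c.dir⟩ := by
    intro c
    rw [bondAvgIter_eq_lineBlockAvg hk X c, RCLike.real_smul_eq_coe_smul (K := ℂ)]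
    simp only [iterate_shift_eq_runSite]
    rfl
  calc ∑ c : PBond P k, ((bondAvgIter k X c)ᴴ * W c).trace
      = ∑ c : PBond P k, w * ∑ x ∈ univ.filter (fun x : Site P 0 => Site.proj k k x = c.src), ∑ t ∈ range (P.L ^ k),
          ((X ⟨runSite x c.dir t, c.dir⟩)ᴴ * W c).trace := by
        refine Finset.sum_congr rfl fun c _ => ?_
        rw [hw c, Matrix.conjTranspose_smul, hwreal, Matrix.smul_mul, Matrix.trace_smul, smul_eq_mul,
          Matrix.conjTranspose_sum, Matrix.sum_mul, Matrix.trace_sum]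
        congr 1
        refine Finset.sum_congr rfl fun x _ => ?_
        rw [Matrix.conjTranspose_sum, Matrix.sum_mul, Matrix.trace_sum]
    _ = w * ∑ μ : Fin P.d, ∑ x : Site P 0, ∑ t ∈ range (P.L ^ k), ((X ⟨runSite x μ t, μ⟩)ᴴ * W ⟨Site.proj k k x, μ⟩).trace := by
        rw [← Finset.mul_sum, sum_pbond, Finset.sum_comm]
        congr 1
        refine Finset.sum_congr rfl fun μ _ => ?_
        rw [← Finset.sum_fiberwise univ (fun x : Site P 0 => Site.proj k k x)
          (fun x => ∑ t ∈ range (P.L ^ k), ((X ⟨runSite x μ t, μ⟩)ᴴ * W ⟨Site.proj k k x, μ⟩).trace)]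
        refine Finset.sum_congr rfl fun y _ => Finset.sum_congr rfl fun x hx => ?_
        rw [(Finset.mem_filter.mp hx).2]
    _ = w * ∑ μ : Fin P.d, ∑ t ∈ range (P.L ^ k), ∑ z : Site P 0,
          ((X ⟨z, μ⟩)ᴴ * W ⟨Site.proj k k (Function.update z μ (z μ - t) : Site P 0), μ⟩).trace := by
        congr 1
        refine Finset.sum_congr rfl fun μ _ => ?_
        rw [Finset.sum_comm]
        refine Finset.sum_congr rfl fun t _ => ?_
        exact sum_runSite_reindex μ t (fun z x => ((X ⟨z, μ⟩)ᴴ * W ⟨Site.proj k k x, μ⟩).trace)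
    _ = w * ∑ z : Site P 0, ∑ μ : Fin P.d, ∑ t ∈ range (P.L ^ k),
          ((X ⟨z, μ⟩)ᴴ * W ⟨Site.proj k k (Function.update z μ (z μ - t) : Site P 0), μ⟩).trace := by
        congr 1
        refine (Finset.sum_congr rfl fun μ _ => Finset.sum_comm).trans ?_
        exact Finset.sum_comm
    _ = ∑ b : PBond P 0, ((X b)ᴴ * (w • ∑ t ∈ range (P.L ^ k),
          W ⟨Site.proj k k (Function.update b.src b.dir (b.src b.dir - t) : Site P 0), b.dir⟩)).trace := by
        rw [sum_pbond, Finset.mul_sum]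
        refine Finset.sum_congr rfl fun z _ => ?_
        rw [Finset.mul_sum]
        refine Finset.sum_congr rfl fun μ _ => ?_
        rw [Matrix.mul_smul, Matrix.trace_smul, smul_eq_mul, Matrix.mul_sum, Matrix.trace_sum]

/-- ★ **THE TENT KERNEL'S SUP ROW**: `‖(Q_kᵀW)(b)‖ ≤ L^{−kd}·max_c ‖W(c)‖` — the `L^k` contours through `b` each carry the weight `(L^{kd}·L^k)⁻¹`, so the TOTAL weight a fine bond receives
is `L^{−kd}` (`= η^d` at the one-level member): the tent, no concentration on the block skeleton. [cite: Balaban1984PropagatorsI, (1.18) p.20, (1.21) p.21] -/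
theorem norm_tentTranspose_le [DecidableEq ι] (W : PBond P k → Matrix ι ι ℂ) {M : ℝ} (hW : ∀ c, ‖W c‖ ≤ M) (b : PBond P 0) :
    ‖((((((P.L : ℝ) ^ k) ^ P.d * (P.L : ℝ) ^ k)⁻¹ : ℝ)) : ℂ) •
        ∑ t ∈ range (P.L ^ k), W ⟨Site.proj k k (Function.update b.src b.dir (b.src b.dir - t) : Site P 0), b.dir⟩‖
      ≤ (((P.L : ℝ) ^ k) ^ P.d)⁻¹ * M := by
  have hL : (0 : ℝ) < (P.L : ℝ) ^ k := pow_pos (by exact_mod_cast P.L_pos) k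
  have hLd : (0 : ℝ) < ((P.L : ℝ) ^ k) ^ P.d := pow_pos hL _
  rw [norm_smul, Complex.norm_real, Real.norm_of_nonneg (by positivity)]
  calc (((P.L : ℝ) ^ k) ^ P.d * (P.L : ℝ) ^ k)⁻¹ *
        ‖∑ t ∈ range (P.L ^ k), W ⟨Site.proj k k (Function.update b.src b.dir (b.src b.dir - t) : Site P 0), b.dir⟩‖
      ≤ (((P.L : ℝ) ^ k) ^ P.d * (P.L : ℝ) ^ k)⁻¹ *
        ∑ t ∈ range (P.L ^ k), ‖W ⟨Site.proj k k (Function.update b.src b.dir (b.src b.dir - t) : Site P 0), b.dir⟩‖ :=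
          mul_le_mul_of_nonneg_left (norm_sum_le _ _) (by positivity)
    _ ≤ (((P.L : ℝ) ^ k) ^ P.d * (P.L : ℝ) ^ k)⁻¹ * ∑ _t ∈ range (P.L ^ k), M :=
          mul_le_mul_of_nonneg_left (Finset.sum_le_sum fun t _ => hW _) (by positivity)
    _ = (((P.L : ℝ) ^ k) ^ P.d)⁻¹ * M := by
          rw [Finset.sum_const, Finset.card_range, nsmul_eq_mul]
          push_cast
          field_simp

end Transpose

/-! ## §3 ★★ THE READBACK OF `Q_k(1)†` AT THE T³ MEMBER: `toL2⁻¹ ∘ Q_k(1)† ∘ toL2B = (cB∕c₀)·(tent transpose ∘ bondShift⁻¹)` and its sup row -/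

section Member

variable {F : T3Family} {n K : ℕ} {h : n ≤ K} {c₀ cB : ℝ} [Fact (0 < c₀)] [Fact (0 < cB)]

/-- The one-level member's block depth `K − n` is in the standing range of the fine torus `F.P K`. [cite: Balaban1985UV3, (1)–(3) p.256] -/
theorem sub_le_m_add_K (h : n ≤ K) : K - n ≤ (F.P K).m + (F.P K).K := by
  show K - n ≤ F.m + K
  omega

/-- ★★ **THE EXPLICIT KERNEL OF `Q_k(1)†` READ BACK ON THE ROUTE CARRIERS** (brick L0d `Qk := η•QL2` at the trivial background; `η·L^{K−n} = 1` by ✓`Qk_one_toL2`): for every block field `Y`,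
`toL2⁻¹(Q_k(1)†(toL2B Y))(⟨z, μ⟩) = (cB∕c₀)·(L^{3(K−n)}·L^{K−n})⁻¹·Σ_{t<L^{K−n}} Y(bondShift⁻¹⟨proj_{K−n}(z − t e_μ), μ⟩)` — the TENT transpose of §2 at the member's weights
(print: `c₀ = η³`, `cB = 1`, so the prefactor `cB∕c₀ · L^{−3(K−n)}` is `1`). [cite: Balaban1985BackgroundPropagators, p.391, (3.11) p.392, (3.16) p.393; Balaban1984PropagatorsI, (1.18) p.20] -/
theorem toL2_symm_adjoint_Qk_one (Y : PBond (F.P n) 0 → Matrix (Fin 2) (Fin 2) ℂ) :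
    (toL2 F K c₀).symm (LinearMap.adjoint (Qk F n K h c₀ cB (1 : GaugeField (F.P K) 0 (Matrix.specialUnitaryGroup (Fin 2) ℂ))) (toL2B F n cB Y))
      = fun b : PBond (F.P K) 0 => (((cB / c₀ : ℝ)) : ℂ) •
          (((((((F.P K).L : ℝ) ^ (K - n)) ^ (F.P K).d * ((F.P K).L : ℝ) ^ (K - n))⁻¹ : ℝ)) : ℂ) •
            ∑ t ∈ range ((F.P K).L ^ (K - n)), Y ((T3LevelShift.bondShift (T3PrintedRegularOrbits.sites_eq F n K h)).symm
              ⟨Site.proj (K - n) (K - n) (Function.update b.src b.dir (b.src b.dir - t) : Site (F.P K) 0), b.dir⟩) := by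
  have hk : K - n ≤ (F.P K).m + (F.P K).K := sub_le_m_add_K h
  set Z : PBond (F.P K) 0 → Matrix (Fin 2) (Fin 2) ℂ := fun b : PBond (F.P K) 0 => (((cB / c₀ : ℝ)) : ℂ) •
          (((((((F.P K).L : ℝ) ^ (K - n)) ^ (F.P K).d * ((F.P K).L : ℝ) ^ (K - n))⁻¹ : ℝ)) : ℂ) •
            ∑ t ∈ range ((F.P K).L ^ (K - n)), Y ((T3LevelShift.bondShift (T3PrintedRegularOrbits.sites_eq F n K h)).symm
              ⟨Site.proj (K - n) (K - n) (Function.update b.src b.dir (b.src b.dir - t) : Site (F.P K) 0), b.dir⟩) with hZ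
  have hc₀ : (c₀ : ℂ) ≠ 0 := by exact_mod_cast (Fact.out : 0 < c₀).ne'
  -- the two vectors have the same scalar products against every `toL2 A`
  have key : ∀ A : PBond (F.P K) 0 → Matrix (Fin 2) (Fin 2) ℂ,
      ⟪toL2 F K c₀ A, LinearMap.adjoint (Qk F n K h c₀ cB (1 : GaugeField (F.P K) 0 (Matrix.specialUnitaryGroup (Fin 2) ℂ))) (toL2B F n cB Y)⟫_ℂ
        = ⟪toL2 F K c₀ A, toL2 F K c₀ Z⟫_ℂ := by
    intro A
    have e1 : ∑ c : PBond (F.P n) 0, ((bondAvgIter (K - n) A ((T3LevelShift.bondShift (T3PrintedRegularOrbits.sites_eq F n K h)) c))ᴴ * Y c).trace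
        = ∑ c' : PBond (F.P K) (K - n), ((bondAvgIter (K - n) A c')ᴴ * Y ((T3LevelShift.bondShift (T3PrintedRegularOrbits.sites_eq F n K h)).symm c')).trace := by
      exact Fintype.sum_equiv (T3LevelShift.bondShift (T3PrintedRegularOrbits.sites_eq F n K h)) _ _ fun c => by rw [Equiv.symm_apply_apply]
    have e2 : ∀ b : PBond (F.P K) 0, ((A b)ᴴ * Z b).trace = (((cB / c₀ : ℝ)) : ℂ) *
        ((A b)ᴴ * ((((((((F.P K).L : ℝ) ^ (K - n)) ^ (F.P K).d * ((F.P K).L : ℝ) ^ (K - n))⁻¹ : ℝ)) : ℂ) •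
            ∑ t ∈ range ((F.P K).L ^ (K - n)), Y ((T3LevelShift.bondShift (T3PrintedRegularOrbits.sites_eq F n K h)).symm
              ⟨Site.proj (K - n) (K - n) (Function.update b.src b.dir (b.src b.dir - t) : Site (F.P K) 0), b.dir⟩))).trace := by
      intro b
      rw [hZ]
      dsimp only
      rw [Matrix.mul_smul, Matrix.trace_smul, smul_eq_mul]
    rw [LinearMap.adjoint_inner_right, Prop7LaplaceAFlatLetters.Qk_one_toL2, Prop7SectET3HilbertLetters.inner_toL2B,
      Prop7SectET3HilbertLetters.inner_toL2]
    rw [e1, sum_trace_conjTranspose_bondAvgIter_mul hk A (fun c' => Y ((T3LevelShift.bondShift (T3PrintedRegularOrbits.sites_eq F n K h)).symm c'))]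
    simp only [e2, ← Finset.mul_sum]
    rw [← mul_assoc]
    congr 1
    push_cast
    field_simp
  have hx : LinearMap.adjoint (Qk F n K h c₀ cB (1 : GaugeField (F.P K) 0 (Matrix.specialUnitaryGroup (Fin 2) ℂ))) (toL2B F n cB Y)
      = toL2 F K c₀ Z := by
    refine ext_inner_left ℂ fun v => ?_
    obtain ⟨A, rfl⟩ : ∃ A, v = toL2 F K c₀ A := ⟨(toL2 F K c₀).symm v, ((toL2 F K c₀).apply_symm_apply v).symm⟩
    exact key A
  rw [hx, LinearEquiv.symm_apply_apply]

/-- ★★ **THE SUP ROW OF `Q_k(1)†` AT THE MEMBER — px19 g4's number BY KERNEL**: for every block field `Y` and every fine bond `b`,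
`‖toL2⁻¹(Q_k(1)†(toL2B Y))(b)‖ ≤ (cB∕c₀)·L^{−3(K−n)}·‖Y‖` — the maximal fine-bond weight of the flat `Q_k†` kernel is `(cB∕c₀)·η³` (tent), so at print's weights (`c₀ = η³`, `cB = 1`) the
readback of `Q_k(1)†` is a sup-norm contraction, UNIFORMLY IN `K` and in the volume. [cite: Balaban1984PropagatorsI, (1.18) p.20; Balaban1985BackgroundPropagators, (3.16) p.393] -/
theorem norm_toL2_symm_adjoint_Qk_one_apply_le (Y : PBond (F.P n) 0 → Matrix (Fin 2) (Fin 2) ℂ) (b : PBond (F.P K) 0) :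
    ‖(toL2 F K c₀).symm (LinearMap.adjoint (Qk F n K h c₀ cB (1 : GaugeField (F.P K) 0 (Matrix.specialUnitaryGroup (Fin 2) ℂ))) (toL2B F n cB Y)) b‖
      ≤ cB / c₀ * (((F.L : ℝ) ^ (K - n)) ^ 3)⁻¹ * ‖Y‖ := by
  have hc₀ : 0 < c₀ := Fact.out
  have hcB : 0 < cB := Fact.out
  rw [toL2_symm_adjoint_Qk_one]
  dsimp only
  rw [norm_smul, Complex.norm_real, Real.norm_of_nonneg (div_nonneg hcB.le hc₀.le), mul_assoc]
  refine mul_le_mul_of_nonneg_left ?_ (div_nonneg hcB.le hc₀.le)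
  have hT := norm_tentTranspose_le (P := F.P K) (k := K - n)
    (fun c' : PBond (F.P K) (K - n) => Y ((T3LevelShift.bondShift (T3PrintedRegularOrbits.sites_eq F n K h)).symm c'))
    (M := ‖Y‖) (fun c' => norm_le_pi_norm Y _) b
  exact hT

/-- ★★ **THE `Q_k†a`-HALF OF THE DISPLAYED (137)-ROWS `h137π`∕`h137Δ` AT THE FLAT MEMBER, AT THE WEIGHT LETTER OF RECORD `a := a₀·(c₀∕cB)·(L^{K−n})³`** (★p1 g17 WORD 10 ∕ ✓`Prop7LaplaceAFlatCoercive`'s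
`a₀·(c₀∕cB)·((F.L:ℝ)^(K−n))^3`): `‖toL2⁻¹(Q_k(1)†(a•toL2B Y))(b)‖ ≤ a₀·‖Y‖` — the weights cancel EXACTLY; the bound is `L`-only (indeed absolute), `K`-UNIFORM.
[cite: Balaban1985Variational, (137) p.298; Balaban1985BackgroundPropagators, (3.26) p.395, (3.16) p.393] -/
theorem norm_toL2_symm_adjoint_Qk_one_smul_apply_le {a₀ : ℝ} (ha₀ : 0 ≤ a₀) (Y : PBond (F.P n) 0 → Matrix (Fin 2) (Fin 2) ℂ) (b : PBond (F.P K) 0) :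
    ‖(toL2 F K c₀).symm (LinearMap.adjoint (Qk F n K h c₀ cB (1 : GaugeField (F.P K) 0 (Matrix.specialUnitaryGroup (Fin 2) ℂ)))
        ((((a₀ * (c₀ / cB) * ((F.L : ℝ) ^ (K - n)) ^ 3 : ℝ)) : ℂ) • toL2B F n cB Y)) b‖ ≤ a₀ * ‖Y‖ := by
  have hc₀ : 0 < c₀ := Fact.out
  have hcB : 0 < cB := Fact.out
  have hL : (0 : ℝ) < ((F.L : ℝ) ^ (K - n)) ^ 3 := by
    have : (0 : ℝ) < F.L := by exact_mod_cast lt_trans zero_lt_one F.hL.2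
    positivity
  have ha : 0 ≤ a₀ * (c₀ / cB) * ((F.L : ℝ) ^ (K - n)) ^ 3 := by positivity
  rw [LinearMap.map_smul, LinearEquiv.map_smul, Pi.smul_apply, norm_smul, Complex.norm_real, Real.norm_of_nonneg ha]
  calc a₀ * (c₀ / cB) * ((F.L : ℝ) ^ (K - n)) ^ 3 *
        ‖(toL2 F K c₀).symm (LinearMap.adjoint (Qk F n K h c₀ cB (1 : GaugeField (F.P K) 0 (Matrix.specialUnitaryGroup (Fin 2) ℂ))) (toL2B F n cB Y)) b‖
      ≤ a₀ * (c₀ / cB) * ((F.L : ℝ) ^ (K - n)) ^ 3 * (cB / c₀ * (((F.L : ℝ) ^ (K - n)) ^ 3)⁻¹ * ‖Y‖) :=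
        mul_le_mul_of_nonneg_left (norm_toL2_symm_adjoint_Qk_one_apply_le Y b) ha
    _ = a₀ * ‖Y‖ := by
        have hx : ((F.L : ℝ) ^ (K - n)) ^ 3 ≠ 0 := hL.ne'
        have hL0 : (F.L : ℝ) ≠ 0 := by exact_mod_cast (lt_trans zero_lt_one F.hL.2).ne'
        field_simp

end Member

/-! ## §4 For the record: the flat members of the displayed rows `hTJ` and `hOp139′π` are trivial (`T_Jᴾ(1) = 0`, `Δ_πᴾ(1) = Δ^η(1)`) -/

section FlatRows

variable {F : T3Family} {n K : ℕ} {h : n ≤ K} {c₀ cB a : ℝ} [Fact (0 < c₀)] [Fact (0 < cB)]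

/-- **`hTJ` AT `U₀ = 1`**: the J-term operator vanishes at the critical flat background (✓`Prop7LaplaceAFlatLetters.TJSlotP_one`), so the displayed sup row holds with ANY `kTJ ≥ 0`.
[cite: Balaban1985BackgroundPropagators, (3.127)–(3.128) p.421, (3.137) p.423] -/
theorem hTJ_row_one {kTJ : ℝ} (hkTJ : 0 ≤ kTJ) (X : PBond (F.P K) 0 → Matrix (Fin 2) (Fin 2) ℂ) (s : ℝ) (hX : ∀ bd, ‖X bd‖ ≤ s)
    (bd : PBond (F.P K) 0) :
    ‖(toL2 F K c₀).symm (TJSlotP F n K h c₀ cB a (1 : GaugeField (F.P K) 0 (Matrix.specialUnitaryGroup (Fin 2) ℂ)) (toL2 F K c₀ X)) bd‖ ≤ kTJ * s := by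
  rw [Prop7LaplaceAFlatLetters.TJSlotP_one, LinearMap.zero_apply, map_zero, Pi.zero_apply, norm_zero]
  exact mul_nonneg hkTJ ((norm_nonneg _).trans (hX bd))

/-- **`hOp139′π` AT `U₀ = 1`**: the slot defect `Δ^η(1) − Δ_πᴾ(1)` vanishes (✓`Prop7LaplaceAFlatCoercive.DeltaPiSlotP_one`), so the displayed sup row holds with ANY `k139π ≥ 0` (and without
the Landau antecedent). [cite: Balaban1985Variational, (138)–(139) p.298; Balaban1985BackgroundPropagators, (3.119) p.419] -/
theorem hOp139π_row_one {k139π : ℝ} (hk : 0 ≤ k139π) (X : PBond (F.P K) 0 → Matrix (Fin 2) (Fin 2) ℂ) (s : ℝ) (hX : ∀ bd, ‖X bd‖ ≤ s)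
    (bd : PBond (F.P K) 0) :
    ‖(toL2 F K c₀).symm (DeltaEta F n K c₀ (1 : GaugeField (F.P K) 0 (Matrix.specialUnitaryGroup (Fin 2) ℂ)) (toL2 F K c₀ X)
        - DeltaPiSlotP F n K h c₀ cB a (1 : GaugeField (F.P K) 0 (Matrix.specialUnitaryGroup (Fin 2) ℂ)) (toL2 F K c₀ X)) bd‖ ≤ k139π * s := by
  rw [Prop7LaplaceAFlatCoercive.DeltaPiSlotP_one, ContinuousLinearMap.coe_coe, sub_self, map_zero, Pi.zero_apply, norm_zero]
  exact mul_nonneg hk ((norm_nonneg _).trans (hX bd))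

end FlatRows


end Summit.QuantumFields.YangMills.Theorems.Prop7QkAdjointFlatKernel

end
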